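import Summits.Ventures.Crystal3D.Theorems.StickyWulffConstantTextureBuildHalfDefect
import Summits.Ventures.Crystal3D.Theorems.StickyWulffConstantTextureLiminfTexShadowVocabulary
import Summits.Ventures.Crystal3D.StickySpheres.FinsetBridge
import HarnessLib

/-!
# TB-1 bricks L-fill (deficiency half) and «fat voids»: filling fully-coordinated sites never raises the deficiency; vacant sites of a saturated cluster are ≥ 6-fold vacant
# (lane T, crux `TextureLiminfV5`, stmt-Ventures-23912; `stub_textureBuild` → TB-0.md §2 TB-B (H3) / TB-A; cf-p1 DECISION (cxiii) «L-fill S–M»)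

HONEST FRAMING. Venture `Summits/Ventures/Crystal3D` (cell `crystal3d-full`), route `route-Ventures-StickyWulffConstant`, helper `--supports` the
law-v5 crux `TextureLiminfV5` (stmt-Ventures-23912).  Pure finite combinatorics (census-free, standard axioms).  Nothing about any texture, cover or wall is
claimed; which sites the cover builder fills (the geometric half of L-fill) is NOT here; rung F-C1 not moved.

WHAT.
* `contactDeficiency_superset_eq` — for `X ⊆ Y`: `D(Y) = D(X) + Σ_{y ∈ Y∖X} (6 − cdeg X y − ½·cdeg (Y∖X) y)` (a new ball costs `6` and repays its bonds to old
  balls fully, its bonds to new balls half).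
* **`contactDeficiency_le_of_fill`** — if every new ball is fully coordinated in `Y` (`12 ≤ cdeg Y y`) then `D(Y) ≤ D(X)`: THE DEFICIENCY HALF OF L-FILL
  (`CellCover.hDef`, TB-0.md (H3)); no packing hypothesis is needed for the inequality.
* `def_le_of_fill` — the labelled form: `range x ⊆ range x'`, `x'` injective, new balls fully coordinated ⇒ `6N' − C(x') ≤ 6N − C(x)`.
* **`six_le_ncard_vacant_of_saturated`** — «FAT VOIDS» (ROUTE.md §73.1): in a `6|6`-saturated cluster (`IsSaturated`), a vacant site `v` of a moved Barlow
  stacking that is admissible (`1 ≤ dist v (x i)` for all `i`) has at most `6` occupied and hence at least `6` VACANT stacking neighbours.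
* `admissible_of_neighbours_on_stacking` — admissibility is automatic when every ball within distance `< 1`… there is none: if all balls at distance `< 2` from
  `v` lie on the stacking, `v` is admissible (points of a moved Barlow stacking are `1`-separated, `le_dist_of_mem_barlowStacking_ideal`).
WHAT THIS IS NOT: no cover, no texture; F-C1 not moved.
-/

noncomputable section

namespace Summit.Ventures.Crystal3D.Theorems

open Finset Summit.Ventures.Crystal3D
open Literature.MathematicalPhysics.StatisticalMechanics (IsHaggSeq barlowStacking contactDeficiency le_dist_of_mem_barlowStacking_ideal)
open Summit.Ventures.Crystal3D.Cruxes.TextureLiminf.TexShadow (E3 stacking touchCount IsSaturated)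
open Summit.Ventures.Crystal3D.TentCertificate (hB hB_sq finite_touching)

/-! ## Filling never raises the deficiency when the new balls are fully coordinated -/

/-- **Adding balls**: for `X ⊆ Y`, `D(Y) = D(X) + Σ_{y ∈ Y ∖ X} (6 − cdeg X y − ½·cdeg (Y ∖ X) y)`. -/
theorem contactDeficiency_superset_eq {X Y : Finset E3} (hXY : X ⊆ Y) :
    contactDeficiency Y = contactDeficiency X +
      ∑ y ∈ Y \ X, ((6 : ℝ) - (cdeg X y : ℝ) - (cdeg (Y \ X) y : ℝ) / 2) := by
  classical
  have hsplit := contactDeficiency_sdiff_split hXY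
  have hD : contactDeficiency (Y \ X) = ∑ y ∈ Y \ X, halfDefect (Y \ X) y := contactDeficiency_eq_sum_halfDefect _
  have hcross : ((((X ×ˢ (Y \ X)).filter fun pq => dist pq.1 pq.2 = 1).card : ℕ) : ℝ) = ∑ y ∈ Y \ X, (cdeg X y : ℝ) := by
    have h1 : ((X ×ˢ (Y \ X)).filter fun pq => dist pq.1 pq.2 = 1).card = crossCount (Y \ X) X := by
      rw [← crossCount_comm]; rfl
    rw [h1, crossCount_eq_sum, Nat.cast_sum]
    rfl
  rw [hsplit, hD, hcross]
  have : ∑ y ∈ Y \ X, halfDefect (Y \ X) y - ∑ y ∈ Y \ X, (cdeg X y : ℝ) =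
      ∑ y ∈ Y \ X, ((6 : ℝ) - (cdeg X y : ℝ) - (cdeg (Y \ X) y : ℝ) / 2) := by
    rw [← Finset.sum_sub_distrib]
    refine Finset.sum_congr rfl fun y _ => ?_
    unfold halfDefect; ring
  linarith

/-- **L-fill, deficiency half**: if `X ⊆ Y` and every ball of `Y ∖ X` has at least twelve contacts in `Y`, then `D(Y) ≤ D(X)`. -/
theorem contactDeficiency_le_of_fill {X Y : Finset E3} (hXY : X ⊆ Y) (hfull : ∀ y ∈ Y \ X, 12 ≤ cdeg Y y) :
    contactDeficiency Y ≤ contactDeficiency X := by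
  classical
  rw [contactDeficiency_superset_eq hXY]
  have hle : ∑ y ∈ Y \ X, ((6 : ℝ) - (cdeg X y : ℝ) - (cdeg (Y \ X) y : ℝ) / 2) ≤ 0 := by
    refine Finset.sum_nonpos fun y hy => ?_
    have h12 := hfull y hy
    have hsum : cdeg Y y = cdeg X y + cdeg (Y \ X) y := by
      have := cdeg_eq_add_sdiff hXY y
      unfold cdeg at this ⊢
      exact this
    have h12' : (12 : ℝ) ≤ (cdeg X y : ℝ) + (cdeg (Y \ X) y : ℝ) := by
      rw [hsum] at h12; exact_mod_cast h12
    have hnn : (0 : ℝ) ≤ (cdeg X y : ℝ) := Nat.cast_nonneg _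
    linarith
  linarith

/-- **L-fill, labelled form**: if `range x ⊆ range x'` (both injective) and every NEW ball of `x'` has at least twelve contacts, then
`6N' − C(x') ≤ 6N − C(x)`. -/
theorem def_le_of_fill {N N' : ℕ} {x : Fin N → E3} {x' : Fin N' → E3} (hx : Function.Injective x) (hx' : Function.Injective x')
    (hsub : Set.range x ⊆ Set.range x')
    (hfull : ∀ j : Fin N', x' j ∉ Set.range x → 12 ≤ cdeg (Finset.univ.image x') (x' j)) :
    6 * (N' : ℝ) - (numContacts x' : ℝ) ≤ 6 * (N : ℝ) - (numContacts x : ℝ) := by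
  classical
  rw [← contactDeficiency_image_eq x hx, ← contactDeficiency_image_eq x' hx']
  refine contactDeficiency_le_of_fill ?_ ?_
  · intro p hp
    obtain ⟨i, -, rfl⟩ := Finset.mem_image.1 hp
    obtain ⟨j, hj⟩ := hsub ⟨i, rfl⟩
    exact Finset.mem_image.2 ⟨j, Finset.mem_univ _, hj⟩
  · intro y hy
    obtain ⟨hy', hyX⟩ := Finset.mem_sdiff.1 hy
    obtain ⟨j, -, rfl⟩ := Finset.mem_image.1 hy'
    refine hfull j fun ⟨i, hi⟩ => hyX ?_
    exact Finset.mem_image.2 ⟨i, Finset.mem_univ _, hi⟩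

/-! ## Fat voids after saturation -/

/-- **FAT VOIDS**: in a `6|6`-saturated cluster, an admissible vacant site `v` of a moved Barlow stacking has at least six vacant stacking neighbours. -/
theorem six_le_ncard_vacant_of_saturated {N : ℕ} {x : Fin N → E3} (hsat : IsSaturated x)
    {L : E3 ≃ₗᵢ[ℝ] E3} {s : E3} {σ : ℤ → ℤ} (hσ : IsHaggSeq σ) {v : E3} (hv : v ∈ stacking L s σ)
    (hadm : ∀ i : Fin N, 1 ≤ dist v (x i)) :
    6 ≤ {w : E3 | w ∈ stacking L s σ ∧ dist v w = 1 ∧ w ∉ Set.range x}.ncard := by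
  classical
  have h6 : touchCount x v ≤ 6 := hsat.2 v hadm
  have hfin := finite_touching hσ hv
  have h12 := ncard_touching_stacking_eq_twelve hσ hv
  -- occupied neighbour sites inject into the touching balls
  set Occ : Set E3 := {w : E3 | w ∈ stacking L s σ ∧ dist v w = 1 ∧ w ∈ Set.range x} with hOcc
  set Vac : Set E3 := {w : E3 | w ∈ stacking L s σ ∧ dist v w = 1 ∧ w ∉ Set.range x} with hVac
  have hOccfin : Occ.Finite := hfin.subset fun w hw => ⟨hw.1, hw.2.1⟩
  have hVacfin : Vac.Finite := hfin.subset fun w hw => ⟨hw.1, hw.2.1⟩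
  have hOcc_le : Occ.ncard ≤ 6 := by
    -- `Occ ⊆ image of the touching indices`
    have hsub : Occ ⊆ ↑((Finset.univ.filter fun i : Fin N => dist v (x i) = 1).image x) := by
      rintro w ⟨-, hd, ⟨i, rfl⟩⟩
      exact Finset.mem_coe.2 (Finset.mem_image.2 ⟨i, Finset.mem_filter.2 ⟨Finset.mem_univ _, hd⟩, rfl⟩)
    calc Occ.ncard ≤ (↑((Finset.univ.filter fun i : Fin N => dist v (x i) = 1).image x) : Set E3).ncard :=
          Set.ncard_le_ncard hsub (Finset.finite_toSet _)
      _ = ((Finset.univ.filter fun i : Fin N => dist v (x i) = 1).image x).card := Set.ncard_coe_finset _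
      _ ≤ (Finset.univ.filter fun i : Fin N => dist v (x i) = 1).card := Finset.card_image_le
      _ = touchCount x v := rfl
      _ ≤ 6 := h6
  have hunion : {y : E3 | y ∈ stacking L s σ ∧ dist v y = 1} = Occ ∪ Vac := by
    ext w; constructor
    · rintro ⟨hw, hd⟩; by_cases h : w ∈ Set.range x
      · exact Or.inl ⟨hw, hd, h⟩
      · exact Or.inr ⟨hw, hd, h⟩
    · rintro (⟨hw, hd, -⟩ | ⟨hw, hd, -⟩) <;> exact ⟨hw, hd⟩
  have hdisj : Disjoint Occ Vac := by
    rw [Set.disjoint_left]; rintro w ⟨-, -, h⟩ ⟨-, -, h'⟩; exact h' h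
  rw [hunion, Set.ncard_union_eq hdisj hOccfin hVacfin] at h12
  omega

/-- **Admissibility inside a grain**: if every ball at distance `< 2` from the stacking site `v` lies on the stacking and `v` itself is vacant, then `v` is
admissible (`1 ≤ dist v (x i)` for all `i`): points of a moved Barlow stacking are `1`-separated. -/
theorem admissible_of_neighbours_on_stacking {N : ℕ} {x : Fin N → E3}
    {L : E3 ≃ₗᵢ[ℝ] E3} {s : E3} {σ : ℤ → ℤ} (hσ : IsHaggSeq σ) {v : E3} (hv : v ∈ stacking L s σ) (hvac : v ∉ Set.range x)
    (hnear : ∀ i : Fin N, dist v (x i) < 2 → x i ∈ stacking L s σ) : ∀ i : Fin N, 1 ≤ dist v (x i) := by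
  intro i
  by_contra hlt
  push Not at hlt
  have hxi := hnear i (by linarith)
  obtain ⟨r, hr, hrv⟩ := hv
  obtain ⟨r', hr', hr'x⟩ := hxi
  have hne : r ≠ r' := by
    rintro rfl; exact hvac ⟨i, by rw [← hr'x, hrv]⟩
  have h1 : (1 : ℝ) ≤ dist r r' := le_dist_of_mem_barlowStacking_ideal hσ one_pos (by rw [hB_sq]; norm_num) hr hr' hne
  have h2 : dist v (x i) = dist r r' := by
    rw [← hrv, ← hr'x, dist_eq_norm, dist_eq_norm, add_sub_add_right_eq_sub, ← map_sub, LinearIsometryEquiv.norm_map]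
  linarith

end Summit.Ventures.Crystal3D.Theorems

end
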